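import Literature.Analysis.Complex.DolbeaultVanishingPolyhedra
import Literature.Analysis.Complex.LocallyUniformLimitSCV
import Mathlib.Algebra.MvPolynomial.Monad
import Mathlib.Analysis.SpecificLimits.Basic
import HarnessLib

/-!
# Newton retraction of an entire polyhedron onto an algebraic set with a first-order retraction

[topic Analysis/Complex]

Let `f₁, …, f_m ∈ ℂ[X_i : i ∈ ι]` (finitely many variables), `J = (f₁, …, f_m)`, and
`Z = V(J) = {z ∈ ℂ^ι : f_j(z) = 0 ∀ j}`. Suppose `J` admits a **first-order retraction**: polynomials
`Φ_i` (`i ∈ ι`) with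

* `Φ_i - X_i ∈ J` (the polynomial map `Φ = (Φ_i)_i : ℂ^ι → ℂ^ι` is the identity on `Z`), and
* `f_j(Φ) ∈ J²` for every `j` (`Φ` maps the first-order thickening `Spec ℂ[X]/J²` into `Z`).

This is exactly the datum "the surjection `P/J² → P/J` has a `ℂ`-algebra section", which exists when
`ℂ[X]/J` is formally smooth over `ℂ` [Stacks 031I; Mathlib `Algebra.FormallySmooth.iff_split_surjection`:
"a first-order thickening of `Spec A` inside `Spec P` admits a retraction"] — e.g. for the ideal of a
smooth affine variety `Y ⊂ 𝔸^ι_ℂ`. We prove: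

* (private steps `exists_newton_estimates`, `newton_step`, `newton_iterate`, `exists_newton_limit`)
  **Newton's iteration `z ↦ Φ(z)` converges, uniformly on the
  open set `V = {z : F(z)·(1 + ‖z‖)^d < ε₀}` (`F = ∑_j |f_j|`), to a holomorphic map `r : V → Z` with
  `r = id` on `Z`.** The two algebraic relations give the estimates `‖Φ z - z‖ ≤ C(1+‖z‖)^d F(z)` and
  `F(Φ z) ≤ C(1+‖z‖)^d F(z)²` (polynomial growth of coefficients, nothing else), whence the quadratic
  invariant `G(Φ z) ≤ G(z)/2` for `G = F·(1+‖·‖)^d ≤ ε₀`; the limit of the polynomial maps `Φ^k` is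
  holomorphic by Weierstrass' theorem in several variables
  (`Literature.Analysis.Complex.SCV.differentiableOn_of_tendstoLocallyUniformlyOn`).
* `NewtonRetract.exists_polyhedron_retract` — `V` contains the OPEN ENTIRE POLYHEDRON
  `W = {|f_j| < η, |f_j X_i^d| < η}`, which contains `Z`; so **`Z` is a holomorphic retract of an open
  polynomial polyhedron of `ℂ^ι`**.
* `NewtonRetract.exists_acyclic_retract` — the form consumed downstream: **`Z` is a holomorphic retract of
  a `∂̄`-ACYCLIC open subset `U ⊆ ℂ^ι`** (`H^{p,q+1}_{∂̄}(U) = 0` for all `p, q` by Hörmander's Thm. 2.7.8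
  for open polyhedra, the tree's `subsingleton_dolbeaultCohomology_of_forall_norm_lt`).

With the biholomorphic invariance of the vanishing of Dolbeault cohomology under holomorphic retracts
(`subsingleton_dolbeaultCohomology_of_leftInverse`, `DolbeaultInvariance`) this is the analytic half of
Cartan's Theorem B in Dolbeault form for smooth affine varieties (Hörmander Cor. 5.2.6 on the Stein
manifold `Y(ℂ)`), proved in `Literature/AlgebraicGeometry/HodgeTheory/SmoothAffineDolbeaultAcyclic.lean`
WITHOUT `L²`-methods on manifolds: the printed route (Hörmander Ch. V) is replaced by the algebraic
first-order retraction + Newton's method + Thm. 2.7.8 on `ℂ^ι`. In print, holomorphic retractions of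
neighbourhoods onto closed Stein submanifolds are Docquier–Grauert's theorem (Math. Ann. 140 (1960)),
there deduced from Theorem B; here the retraction comes first and Theorem B is the consequence.

Everything is proved; theorems only (the Newton steps are private helpers); no definitions, no named facts.

## References

* The Stacks Project, Tag 031I (formal smoothness and splitting of the conormal sequence / retraction of
  the first-order thickening) [StacksProject].
* L. Hörmander, *An Introduction to Complex Analysis in Several Variables* (1973), Thm. 2.7.8, Cor. 2.2.5,
  Cor. 5.2.6 [HormanderSCV1973].
* F. Docquier, H. Grauert, *Levisches Problem und Rungescher Satz für Teilgebiete Steinscher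
  Mannigfaltigkeiten*, Math. Ann. 140 (1960) 94–123 (holomorphic neighbourhood retractions)
  [DocquierGrauert1960].
-/

noncomputable section

open scoped Topology
open Complex Set Filter Metric MvPolynomial
open Literature.NumberTheory.Transcendental

namespace Literature.Analysis.Complex

namespace NewtonRetract

universe u

variable {ι : Type u} [Fintype ι]

/-! ### Polynomial growth of polynomial functions -/

/-- **Polynomial growth**: `|p(z)| ≤ C (1 + ‖z‖)^d` on `ℂ^ι` for every polynomial `p` (induction on `p`;
`‖z_i‖ ≤ ‖z‖` for the sup norm). [folklore] -/
private theorem exists_norm_eval_le (p : MvPolynomial ι ℂ) :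
    ∃ (C : ℝ) (d : ℕ), 0 ≤ C ∧ ∀ z : ι → ℂ, ‖eval z p‖ ≤ C * (1 + ‖z‖) ^ d := by
  induction p using MvPolynomial.induction_on with
  | C a => exact ⟨‖a‖, 0, norm_nonneg a, fun z => by simp⟩
  | add p q hp hq =>
    obtain ⟨C₁, d₁, hC₁, h₁⟩ := hp
    obtain ⟨C₂, d₂, hC₂, h₂⟩ := hq
    refine ⟨C₁ + C₂, max d₁ d₂, by positivity, fun z => ?_⟩
    have h1z : (1 : ℝ) ≤ 1 + ‖z‖ := le_add_of_nonneg_right (norm_nonneg z)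
    calc ‖eval z (p + q)‖ = ‖eval z p + eval z q‖ := by rw [map_add]
      _ ≤ ‖eval z p‖ + ‖eval z q‖ := norm_add_le _ _
      _ ≤ C₁ * (1 + ‖z‖) ^ d₁ + C₂ * (1 + ‖z‖) ^ d₂ := add_le_add (h₁ z) (h₂ z)
      _ ≤ C₁ * (1 + ‖z‖) ^ max d₁ d₂ + C₂ * (1 + ‖z‖) ^ max d₁ d₂ :=
        add_le_add (mul_le_mul_of_nonneg_left (pow_le_pow_right₀ h1z (le_max_left _ _)) hC₁)
          (mul_le_mul_of_nonneg_left (pow_le_pow_right₀ h1z (le_max_right _ _)) hC₂)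
      _ = (C₁ + C₂) * (1 + ‖z‖) ^ max d₁ d₂ := by ring
  | mul_X p i hp =>
    obtain ⟨C, d, hC, h⟩ := hp
    refine ⟨C, d + 1, hC, fun z => ?_⟩
    have hzi : ‖z i‖ ≤ 1 + ‖z‖ := (norm_le_pi_norm z i).trans (le_add_of_nonneg_left zero_le_one)
    calc ‖eval z (p * X i)‖ = ‖eval z p‖ * ‖z i‖ := by rw [map_mul, eval_X, norm_mul]
      _ ≤ C * (1 + ‖z‖) ^ d * (1 + ‖z‖) :=
        mul_le_mul (h z) hzi (norm_nonneg _) (mul_nonneg hC (pow_nonneg (by positivity) _))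
      _ = C * (1 + ‖z‖) ^ (d + 1) := by ring

/-! ### Bounds along an ideal: `J` and `J²` in terms of `F = ∑_j |f_j|` -/

variable {m : ℕ} (f : Fin m → MvPolynomial ι ℂ)

/-- **Members of `J = (f₁,…,f_m)` are `O((1+‖z‖)^d) · F(z)`**, `F = ∑_j |f_j|` (write `q = ∑ a_j f_j`).
[folklore] -/
private theorem exists_norm_eval_le_of_mem_span {q : MvPolynomial ι ℂ}
    (hq : q ∈ Ideal.span (Set.range f)) :
    ∃ (C : ℝ) (d : ℕ), 0 ≤ C ∧
      ∀ z : ι → ℂ, ‖eval z q‖ ≤ C * (1 + ‖z‖) ^ d * ∑ j, ‖eval z (f j)‖ := by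
  induction hq using Submodule.span_induction with
  | mem x hx =>
    obtain ⟨j, rfl⟩ := hx
    refine ⟨1, 0, zero_le_one, fun z => ?_⟩
    simpa using Finset.single_le_sum (f := fun j => ‖eval z (f j)‖) (fun _ _ => norm_nonneg _)
      (Finset.mem_univ j)
  | zero => exact ⟨0, 0, le_rfl, fun z => by simp⟩
  | add x y _ _ hx hy =>
    obtain ⟨C₁, d₁, hC₁, h₁⟩ := hx
    obtain ⟨C₂, d₂, hC₂, h₂⟩ := hy
    refine ⟨C₁ + C₂, max d₁ d₂, by positivity, fun z => ?_⟩
    have h1z : (1 : ℝ) ≤ 1 + ‖z‖ := le_add_of_nonneg_right (norm_nonneg z)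
    have hF : 0 ≤ ∑ j, ‖eval z (f j)‖ := Finset.sum_nonneg fun _ _ => norm_nonneg _
    calc ‖eval z (x + y)‖ ≤ ‖eval z x‖ + ‖eval z y‖ := by rw [map_add]; exact norm_add_le _ _
      _ ≤ C₁ * (1 + ‖z‖) ^ d₁ * ∑ j, ‖eval z (f j)‖ + C₂ * (1 + ‖z‖) ^ d₂ * ∑ j, ‖eval z (f j)‖ :=
        add_le_add (h₁ z) (h₂ z)
      _ ≤ C₁ * (1 + ‖z‖) ^ max d₁ d₂ * ∑ j, ‖eval z (f j)‖ +
          C₂ * (1 + ‖z‖) ^ max d₁ d₂ * ∑ j, ‖eval z (f j)‖ :=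
        add_le_add
          (mul_le_mul_of_nonneg_right
            (mul_le_mul_of_nonneg_left (pow_le_pow_right₀ h1z (le_max_left _ _)) hC₁) hF)
          (mul_le_mul_of_nonneg_right
            (mul_le_mul_of_nonneg_left (pow_le_pow_right₀ h1z (le_max_right _ _)) hC₂) hF)
      _ = (C₁ + C₂) * (1 + ‖z‖) ^ max d₁ d₂ * ∑ j, ‖eval z (f j)‖ := by ring
  | smul a x _ hx =>
    obtain ⟨C, d, hC, h⟩ := hx
    obtain ⟨Ca, da, hCa, ha⟩ := exists_norm_eval_le a
    refine ⟨Ca * C, da + d, by positivity, fun z => ?_⟩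
    have hF : 0 ≤ ∑ j, ‖eval z (f j)‖ := Finset.sum_nonneg fun _ _ => norm_nonneg _
    calc ‖eval z (a • x)‖ = ‖eval z a‖ * ‖eval z x‖ := by rw [smul_eq_mul, map_mul, norm_mul]
      _ ≤ Ca * (1 + ‖z‖) ^ da * (C * (1 + ‖z‖) ^ d * ∑ j, ‖eval z (f j)‖) :=
        mul_le_mul (ha z) (h z) (norm_nonneg _) (mul_nonneg hCa (pow_nonneg (by positivity) _))
      _ = Ca * C * (1 + ‖z‖) ^ (da + d) * ∑ j, ‖eval z (f j)‖ := by ring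

/-- **Members of `J²` are `O((1+‖z‖)^d) · F(z)²`** (`J² = J·J` is additively generated by products).
[folklore] -/
private theorem exists_norm_eval_le_of_mem_span_sq {q : MvPolynomial ι ℂ}
    (hq : q ∈ Ideal.span (Set.range f) ^ 2) :
    ∃ (C : ℝ) (d : ℕ), 0 ≤ C ∧
      ∀ z : ι → ℂ, ‖eval z q‖ ≤ C * (1 + ‖z‖) ^ d * (∑ j, ‖eval z (f j)‖) ^ 2 := by
  rw [pow_two] at hq
  refine Submodule.mul_induction_on hq ?_ ?_
  · intro x hx y hy
    obtain ⟨C₁, d₁, hC₁, h₁⟩ := exists_norm_eval_le_of_mem_span f hx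
    obtain ⟨C₂, d₂, hC₂, h₂⟩ := exists_norm_eval_le_of_mem_span f hy
    refine ⟨C₁ * C₂, d₁ + d₂, by positivity, fun z => ?_⟩
    have hF : 0 ≤ ∑ j, ‖eval z (f j)‖ := Finset.sum_nonneg fun _ _ => norm_nonneg _
    calc ‖eval z (x * y)‖ = ‖eval z x‖ * ‖eval z y‖ := by rw [map_mul, norm_mul]
      _ ≤ (C₁ * (1 + ‖z‖) ^ d₁ * ∑ j, ‖eval z (f j)‖) * (C₂ * (1 + ‖z‖) ^ d₂ * ∑ j, ‖eval z (f j)‖) :=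
        mul_le_mul (h₁ z) (h₂ z) (norm_nonneg _)
          (mul_nonneg (mul_nonneg hC₁ (pow_nonneg (by positivity) _)) hF)
      _ = C₁ * C₂ * (1 + ‖z‖) ^ (d₁ + d₂) * (∑ j, ‖eval z (f j)‖) ^ 2 := by ring
  · intro x y hx hy
    obtain ⟨C₁, d₁, hC₁, h₁⟩ := hx
    obtain ⟨C₂, d₂, hC₂, h₂⟩ := hy
    refine ⟨C₁ + C₂, max d₁ d₂, by positivity, fun z => ?_⟩
    have h1z : (1 : ℝ) ≤ 1 + ‖z‖ := le_add_of_nonneg_right (norm_nonneg z)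
    have hF : 0 ≤ (∑ j, ‖eval z (f j)‖) ^ 2 := sq_nonneg _
    calc ‖eval z (x + y)‖ ≤ ‖eval z x‖ + ‖eval z y‖ := by rw [map_add]; exact norm_add_le _ _
      _ ≤ C₁ * (1 + ‖z‖) ^ d₁ * (∑ j, ‖eval z (f j)‖) ^ 2 +
          C₂ * (1 + ‖z‖) ^ d₂ * (∑ j, ‖eval z (f j)‖) ^ 2 := add_le_add (h₁ z) (h₂ z)
      _ ≤ C₁ * (1 + ‖z‖) ^ max d₁ d₂ * (∑ j, ‖eval z (f j)‖) ^ 2 +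
          C₂ * (1 + ‖z‖) ^ max d₁ d₂ * (∑ j, ‖eval z (f j)‖) ^ 2 :=
        add_le_add
          (mul_le_mul_of_nonneg_right
            (mul_le_mul_of_nonneg_left (pow_le_pow_right₀ h1z (le_max_left _ _)) hC₁) hF)
          (mul_le_mul_of_nonneg_right
            (mul_le_mul_of_nonneg_left (pow_le_pow_right₀ h1z (le_max_right _ _)) hC₂) hF)
      _ = (C₁ + C₂) * (1 + ‖z‖) ^ max d₁ d₂ * (∑ j, ‖eval z (f j)‖) ^ 2 := by ring


/-! ### The Newton estimates of a first-order retraction -/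

omit [Fintype ι] in
/-- `p(Φ(z)) = (p ∘ Φ)(z)`: evaluating `bind₁ Φ p` at `z` is evaluating `p` at the point
`(Φ_i(z))_i`. [folklore] -/
private theorem eval_bind₁_eq (Φ : ι → MvPolynomial ι ℂ) (p : MvPolynomial ι ℂ) (z : ι → ℂ) :
    eval z (bind₁ Φ p) = eval (fun i => eval z (Φ i)) p :=
  eval₂Hom_bind₁ _ _ _ _

/-- **The two Newton estimates.** If `Φ_i - X_i ∈ J` and `f_j(Φ) ∈ J²` (`J = (f₁,…,f_m)`), then with
`F = ∑_j |f_j|` there are `C ≥ 1`, `d ≥ 1` with, for all `z ∈ ℂ^ι`,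
`‖Φ(z) - z‖ ≤ C (1+‖z‖)^d F(z)` and `F(Φ(z)) ≤ C (1+‖z‖)^d F(z)²`. [folklore] -/
private theorem exists_newton_estimates (Φ : ι → MvPolynomial ι ℂ)
    (hΦ₁ : ∀ i, Φ i - X i ∈ Ideal.span (Set.range f))
    (hΦ₂ : ∀ j, bind₁ Φ (f j) ∈ Ideal.span (Set.range f) ^ 2) :
    ∃ (C : ℝ) (d : ℕ), 1 ≤ C ∧ 1 ≤ d ∧ ∀ z : ι → ℂ,
      ‖(fun i => eval z (Φ i)) - z‖ ≤ C * (1 + ‖z‖) ^ d * ∑ j, ‖eval z (f j)‖ ∧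
      ∑ j, ‖eval (fun i => eval z (Φ i)) (f j)‖ ≤
        C * (1 + ‖z‖) ^ d * (∑ j, ‖eval z (f j)‖) ^ 2 := by
  classical
  choose C₁ d₁ hC₁ h₁ using fun i => exists_norm_eval_le_of_mem_span f (hΦ₁ i)
  choose C₂ d₂ hC₂ h₂ using fun j => exists_norm_eval_le_of_mem_span_sq f (hΦ₂ j)
  refine ⟨1 + ∑ i, C₁ i + ∑ j, C₂ j, 1 + ∑ i, d₁ i + ∑ j, d₂ j, ?_, ?_, fun z => ⟨?_, ?_⟩⟩
  · have : 0 ≤ ∑ i, C₁ i := Finset.sum_nonneg fun i _ => hC₁ i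
    have : 0 ≤ ∑ j, C₂ j := Finset.sum_nonneg fun j _ => hC₂ j
    linarith
  · omega
  · -- `‖Φ z - z‖`: coordinatewise, `Φ_i(z) - z_i = (Φ_i - X_i)(z)`
    have h1z : (1 : ℝ) ≤ 1 + ‖z‖ := le_add_of_nonneg_right (norm_nonneg z)
    have hF : 0 ≤ ∑ j, ‖eval z (f j)‖ := Finset.sum_nonneg fun _ _ => norm_nonneg _
    have hC : 0 ≤ 1 + ∑ i, C₁ i + ∑ j, C₂ j := by
      have : 0 ≤ ∑ i, C₁ i := Finset.sum_nonneg fun i _ => hC₁ i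
      have : 0 ≤ ∑ j, C₂ j := Finset.sum_nonneg fun j _ => hC₂ j
      linarith
    refine (pi_norm_le_iff_of_nonneg (by positivity)).2 fun i => ?_
    have hi : C₁ i ≤ 1 + ∑ i, C₁ i + ∑ j, C₂ j := by
      have : C₁ i ≤ ∑ i, C₁ i := Finset.single_le_sum (fun i _ => hC₁ i) (Finset.mem_univ i)
      have : 0 ≤ ∑ j, C₂ j := Finset.sum_nonneg fun j _ => hC₂ j
      linarith
    have hdi : d₁ i ≤ 1 + ∑ i, d₁ i + ∑ j, d₂ j := by
      have : d₁ i ≤ ∑ i, d₁ i := Finset.single_le_sum (fun i _ => Nat.zero_le _) (Finset.mem_univ i)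
      omega
    calc ‖((fun i => eval z (Φ i)) - z) i‖ = ‖eval z (Φ i - X i)‖ := by simp
      _ ≤ C₁ i * (1 + ‖z‖) ^ d₁ i * ∑ j, ‖eval z (f j)‖ := h₁ i z
      _ ≤ (1 + ∑ i, C₁ i + ∑ j, C₂ j) * (1 + ‖z‖) ^ (1 + ∑ i, d₁ i + ∑ j, d₂ j) *
            ∑ j, ‖eval z (f j)‖ :=
        mul_le_mul_of_nonneg_right
          (mul_le_mul hi (pow_le_pow_right₀ h1z hdi) (pow_nonneg (by positivity) _) hC) hF
  · -- `F (Φ z)`: termwise, `f_j(Φ z) = (bind₁ Φ f_j)(z)`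
    have h1z : (1 : ℝ) ≤ 1 + ‖z‖ := le_add_of_nonneg_right (norm_nonneg z)
    have hF : 0 ≤ (∑ j, ‖eval z (f j)‖) ^ 2 := sq_nonneg _
    have hC : 0 ≤ 1 + ∑ i, C₁ i + ∑ j, C₂ j := by
      have : 0 ≤ ∑ i, C₁ i := Finset.sum_nonneg fun i _ => hC₁ i
      have : 0 ≤ ∑ j, C₂ j := Finset.sum_nonneg fun j _ => hC₂ j
      linarith
    calc ∑ j, ‖eval (fun i => eval z (Φ i)) (f j)‖ = ∑ j, ‖eval z (bind₁ Φ (f j))‖ := by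
          simp_rw [eval_bind₁_eq]
      _ ≤ ∑ j, C₂ j * (1 + ‖z‖) ^ d₂ j * (∑ j, ‖eval z (f j)‖) ^ 2 :=
          Finset.sum_le_sum fun j _ => h₂ j z
      _ ≤ ∑ j, C₂ j * (1 + ‖z‖) ^ (1 + ∑ i, d₁ i + ∑ j, d₂ j) * (∑ j, ‖eval z (f j)‖) ^ 2 := by
          refine Finset.sum_le_sum fun j _ => ?_
          have hdj : d₂ j ≤ 1 + ∑ i, d₁ i + ∑ j, d₂ j := by
            have : d₂ j ≤ ∑ j, d₂ j :=
              Finset.single_le_sum (fun j _ => Nat.zero_le _) (Finset.mem_univ j)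
            omega
          exact mul_le_mul_of_nonneg_right
            (mul_le_mul_of_nonneg_left (pow_le_pow_right₀ h1z hdj) (hC₂ j)) hF
      _ = (∑ j, C₂ j) * (1 + ‖z‖) ^ (1 + ∑ i, d₁ i + ∑ j, d₂ j) * (∑ j, ‖eval z (f j)‖) ^ 2 := by
          rw [Finset.sum_mul, Finset.sum_mul]
      _ ≤ (1 + ∑ i, C₁ i + ∑ j, C₂ j) * (1 + ‖z‖) ^ (1 + ∑ i, d₁ i + ∑ j, d₂ j) *
            (∑ j, ‖eval z (f j)‖) ^ 2 := by
          have : ∑ j, C₂ j ≤ 1 + ∑ i, C₁ i + ∑ j, C₂ j := by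
            have : 0 ≤ ∑ i, C₁ i := Finset.sum_nonneg fun i _ => hC₁ i
            linarith
          exact mul_le_mul_of_nonneg_right
            (mul_le_mul_of_nonneg_right this (pow_nonneg (by positivity) _)) hF

/-- **The quadratic step.** Under the two Newton estimates with constants `C ≥ 1`, `d ≥ 1`, put
`G(z) = F(z) (1+‖z‖)^d` and `ε₀ = 1/(2^(d+1) C)`. If `G(z) ≤ ε₀` then `‖Φ z - z‖ ≤ C · G(z)` (in
particular `≤ 1`) and `G(Φ z) ≤ G(z)/2`. [folklore] -/
private theorem newton_step {C : ℝ} {d : ℕ} (hC : 1 ≤ C) {Φv : (ι → ℂ) → (ι → ℂ)} {F : (ι → ℂ) → ℝ}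
    (hF0 : ∀ z, 0 ≤ F z)
    (hΦ : ∀ z, ‖Φv z - z‖ ≤ C * (1 + ‖z‖) ^ d * F z)
    (hFΦ : ∀ z, F (Φv z) ≤ C * (1 + ‖z‖) ^ d * F z ^ 2)
    {z : ι → ℂ} (hz : F z * (1 + ‖z‖) ^ d ≤ 1 / (2 ^ (d + 1) * C)) :
    ‖Φv z - z‖ ≤ C * (F z * (1 + ‖z‖) ^ d) ∧ ‖Φv z - z‖ ≤ 1 ∧
      F (Φv z) * (1 + ‖Φv z‖) ^ d ≤ F z * (1 + ‖z‖) ^ d / 2 := by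
  have hCpos : 0 < C := lt_of_lt_of_le one_pos hC
  have h1z : (1 : ℝ) ≤ 1 + ‖z‖ := le_add_of_nonneg_right (norm_nonneg z)
  have hN : 0 < (1 + ‖z‖) ^ d := pow_pos (by positivity) _
  have hG0 : 0 ≤ F z * (1 + ‖z‖) ^ d := mul_nonneg (hF0 z) hN.le
  have h2d : (1 : ℝ) ≤ 2 ^ (d + 1) := one_le_pow₀ (by norm_num)
  -- `ε₀ ≤ 1/C`
  have hε : 1 / (2 ^ (d + 1) * C) ≤ 1 / C :=
    one_div_le_one_div_of_le hCpos (le_mul_of_one_le_left hCpos.le h2d)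
  have hstep : ‖Φv z - z‖ ≤ C * (F z * (1 + ‖z‖) ^ d) := by
    calc ‖Φv z - z‖ ≤ C * (1 + ‖z‖) ^ d * F z := hΦ z
      _ = C * (F z * (1 + ‖z‖) ^ d) := by ring
  have hstep1 : ‖Φv z - z‖ ≤ 1 := by
    calc ‖Φv z - z‖ ≤ C * (F z * (1 + ‖z‖) ^ d) := hstep
      _ ≤ C * (1 / C) := mul_le_mul_of_nonneg_left (hz.trans hε) hCpos.le
      _ = 1 := by field_simp
  refine ⟨hstep, hstep1, ?_⟩
  -- `1 + ‖Φ z‖ ≤ 2 (1 + ‖z‖)`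
  have hnorm : 1 + ‖Φv z‖ ≤ 2 * (1 + ‖z‖) := by
    have : ‖Φv z‖ ≤ ‖Φv z - z‖ + ‖z‖ := norm_le_norm_sub_add _ _
    linarith [norm_nonneg z]
  have hpow : (1 + ‖Φv z‖) ^ d ≤ 2 ^ d * (1 + ‖z‖) ^ d := by
    rw [← mul_pow]; exact pow_le_pow_left₀ (by positivity) hnorm _
  calc F (Φv z) * (1 + ‖Φv z‖) ^ d
      ≤ (C * (1 + ‖z‖) ^ d * F z ^ 2) * (2 ^ d * (1 + ‖z‖) ^ d) :=
        mul_le_mul (hFΦ z) hpow (pow_nonneg (by positivity) _)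
          (mul_nonneg (mul_nonneg hCpos.le hN.le) (sq_nonneg _))
    _ = (2 ^ (d + 1) * C * (F z * (1 + ‖z‖) ^ d)) * (F z * (1 + ‖z‖) ^ d) / 2 := by ring
    _ ≤ 1 * (F z * (1 + ‖z‖) ^ d) / 2 := by
        gcongr
        calc 2 ^ (d + 1) * C * (F z * (1 + ‖z‖) ^ d) ≤ 2 ^ (d + 1) * C * (1 / (2 ^ (d + 1) * C)) :=
              mul_le_mul_of_nonneg_left hz (by positivity)
          _ = 1 := by field_simp
    _ = F z * (1 + ‖z‖) ^ d / 2 := by ring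


/-! ### Convergence of Newton's iteration -/

/-- **The iterates.** Under the hypotheses of `newton_step`, if `G(z) ≤ ε₀` then for every `k`:
`G(Φ^k z) ≤ G(z)/2^k` and `‖Φ^{k+1} z - Φ^k z‖ ≤ C G(z)/2^k`. [folklore] -/
private theorem newton_iterate {C : ℝ} {d : ℕ} (hC : 1 ≤ C) {Φv : (ι → ℂ) → (ι → ℂ)} {F : (ι → ℂ) → ℝ}
    (hF0 : ∀ z, 0 ≤ F z)
    (hΦ : ∀ z, ‖Φv z - z‖ ≤ C * (1 + ‖z‖) ^ d * F z)
    (hFΦ : ∀ z, F (Φv z) ≤ C * (1 + ‖z‖) ^ d * F z ^ 2)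
    {z : ι → ℂ} (hz : F z * (1 + ‖z‖) ^ d ≤ 1 / (2 ^ (d + 1) * C)) (k : ℕ) :
    F (Φv^[k] z) * (1 + ‖Φv^[k] z‖) ^ d ≤ F z * (1 + ‖z‖) ^ d / 2 ^ k ∧
      ‖Φv^[k + 1] z - Φv^[k] z‖ ≤ C * (F z * (1 + ‖z‖) ^ d) / 2 ^ k := by
  have hG0 : 0 ≤ F z * (1 + ‖z‖) ^ d := mul_nonneg (hF0 z) (pow_nonneg (by positivity) _)
  -- the first claim by induction, the second from it and `newton_step`
  have h1 : ∀ k, F (Φv^[k] z) * (1 + ‖Φv^[k] z‖) ^ d ≤ F z * (1 + ‖z‖) ^ d / 2 ^ k := by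
    intro k
    induction k with
    | zero => simp
    | succ k ih =>
      have hk : F (Φv^[k] z) * (1 + ‖Φv^[k] z‖) ^ d ≤ 1 / (2 ^ (d + 1) * C) :=
        ih.trans ((div_le_self hG0 (one_le_pow₀ (by norm_num))).trans hz)
      have := (newton_step hC hF0 hΦ hFΦ hk).2.2
      rw [Function.iterate_succ_apply']
      calc F (Φv (Φv^[k] z)) * (1 + ‖Φv (Φv^[k] z)‖) ^ d
          ≤ F (Φv^[k] z) * (1 + ‖Φv^[k] z‖) ^ d / 2 := this
        _ ≤ F z * (1 + ‖z‖) ^ d / 2 ^ k / 2 := by gcongr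
        _ = F z * (1 + ‖z‖) ^ d / 2 ^ (k + 1) := by rw [pow_succ, div_div]
  refine ⟨h1 k, ?_⟩
  have hk : F (Φv^[k] z) * (1 + ‖Φv^[k] z‖) ^ d ≤ 1 / (2 ^ (d + 1) * C) :=
    (h1 k).trans ((div_le_self hG0 (one_le_pow₀ (by norm_num))).trans hz)
  have := (newton_step hC hF0 hΦ hFΦ hk).1
  rw [Function.iterate_succ_apply']
  calc ‖Φv (Φv^[k] z) - Φv^[k] z‖ ≤ C * (F (Φv^[k] z) * (1 + ‖Φv^[k] z‖) ^ d) := this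
    _ ≤ C * (F z * (1 + ‖z‖) ^ d / 2 ^ k) :=
        mul_le_mul_of_nonneg_left (h1 k) (zero_le_one.trans hC)
    _ = C * (F z * (1 + ‖z‖) ^ d) / 2 ^ k := by ring

/-- **Newton's method converges to a holomorphic retraction.** Let `Φ : ℂ^ι → ℂ^ι` be holomorphic and
`F ≥ 0` continuous with `‖Φ z - z‖ ≤ C(1+‖z‖)^d F(z)` and `F(Φ z) ≤ C(1+‖z‖)^d F(z)²` (`C, d ≥ 1`). On
the open set `V = {z : F(z)(1+‖z‖)^d < ε₀}`, `ε₀ = 1/(2^(d+1) C)`, the iterates `Φ^k` converge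
UNIFORMLY to a map `r`, holomorphic on `V` (Weierstrass), with `F ∘ r = 0` on `V` and `r z = z`
wherever `F z = 0` (Weierstrass: Hörmander Cor. 2.2.5). [folklore] -/
private theorem exists_newton_limit {C : ℝ} {d : ℕ} (hC : 1 ≤ C) {Φv : (ι → ℂ) → (ι → ℂ)} {F : (ι → ℂ) → ℝ}
    (hF0 : ∀ z, 0 ≤ F z) (hFc : Continuous F) (hΦd : Differentiable ℂ Φv)
    (hΦ : ∀ z, ‖Φv z - z‖ ≤ C * (1 + ‖z‖) ^ d * F z)
    (hFΦ : ∀ z, F (Φv z) ≤ C * (1 + ‖z‖) ^ d * F z ^ 2) :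
    ∃ r : (ι → ℂ) → (ι → ℂ),
      TendstoUniformlyOn (fun k => Φv^[k]) r atTop
        {z | F z * (1 + ‖z‖) ^ d < 1 / (2 ^ (d + 1) * C)} ∧
      DifferentiableOn ℂ r {z | F z * (1 + ‖z‖) ^ d < 1 / (2 ^ (d + 1) * C)} ∧
      (∀ z, F z * (1 + ‖z‖) ^ d < 1 / (2 ^ (d + 1) * C) → F (r z) = 0) ∧
      ∀ z, F z = 0 → r z = z := by
  set ε : ℝ := 1 / (2 ^ (d + 1) * C) with hε
  set V : Set (ι → ℂ) := {z | F z * (1 + ‖z‖) ^ d < ε} with hV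
  have hCpos : 0 < C := lt_of_lt_of_le one_pos hC
  have hεpos : 0 < ε := by rw [hε]; positivity
  -- the geometric bound on consecutive iterates, uniform on `V`
  have hgeom : ∀ z ∈ V, ∀ k, dist (Φv^[k] z) (Φv^[k + 1] z) ≤ 2 * C * ε / 2 / 2 ^ k := by
    intro z hz k
    have hz' : F z * (1 + ‖z‖) ^ d ≤ ε := le_of_lt hz
    rw [dist_comm, dist_eq_norm]
    calc ‖Φv^[k + 1] z - Φv^[k] z‖ ≤ C * (F z * (1 + ‖z‖) ^ d) / 2 ^ k :=
          (newton_iterate hC hF0 hΦ hFΦ hz' k).2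
      _ ≤ C * ε / 2 ^ k := by gcongr
      _ = 2 * C * ε / 2 / 2 ^ k := by ring
  -- the limit map
  set r : (ι → ℂ) → (ι → ℂ) := fun z => limUnder atTop fun k => Φv^[k] z with hr
  have hconv : ∀ z ∈ V, Tendsto (fun k => Φv^[k] z) atTop (𝓝 (r z)) := by
    intro z hz
    exact tendsto_nhds_limUnder (cauchySeq_tendsto_of_complete (cauchySeq_of_le_geometric_two (hgeom z hz)))
  have hdist : ∀ z ∈ V, ∀ k, dist (Φv^[k] z) (r z) ≤ 2 * C * ε / 2 ^ k := fun z hz k =>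
    dist_le_of_le_geometric_two_of_tendsto (hgeom z hz) (hconv z hz) k
  -- uniform convergence on `V`
  have hunif : TendstoUniformlyOn (fun k => Φv^[k]) r atTop V := by
    rw [Metric.tendstoUniformlyOn_iff]
    intro δ hδ
    have hlim : Tendsto (fun k : ℕ => 2 * C * ε / 2 ^ k) atTop (𝓝 0) :=
      tendsto_const_nhds.div_atTop (tendsto_pow_atTop_atTop_of_one_lt one_lt_two)
    filter_upwards [hlim.eventually (gt_mem_nhds hδ)] with k hk z hz
    rw [dist_comm]
    exact (hdist z hz k).trans_lt hk
  have hVo : IsOpen V :=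
    isOpen_lt (hFc.mul ((continuous_const.add continuous_norm).pow d)) continuous_const
  refine ⟨r, hunif, ?_, ?_, ?_⟩
  · -- holomorphy: Weierstrass' theorem for the polynomial (holomorphic) maps `Φ^k`
    haveI : (atTop : Filter ℕ).NeBot := atTop_neBot
    exact SCV.differentiableOn_of_tendstoLocallyUniformlyOn hVo
      (fun k => (hΦd.iterate k).differentiableOn) hunif.tendstoLocallyUniformlyOn
  · -- `F (r z) = 0`: `F (Φ^k z) ≤ G(Φ^k z) ≤ G(z)/2^k → 0`
    intro z hz
    have hzV : z ∈ V := hz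
    have h1 : Tendsto (fun k => F (Φv^[k] z)) atTop (𝓝 (F (r z))) :=
      (hFc.tendsto _).comp (hconv z hzV)
    have h2 : Tendsto (fun k : ℕ => F z * (1 + ‖z‖) ^ d / 2 ^ k) atTop (𝓝 0) :=
      tendsto_const_nhds.div_atTop (tendsto_pow_atTop_atTop_of_one_lt one_lt_two)
    have h3 : ∀ k, F (Φv^[k] z) ≤ F z * (1 + ‖z‖) ^ d / 2 ^ k := fun k => by
      have hk := (newton_iterate hC hF0 hΦ hFΦ (le_of_lt hz) k).1
      refine le_trans ?_ hk
      exact le_mul_of_one_le_right (hF0 _)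
        (one_le_pow₀ (le_add_of_nonneg_right (norm_nonneg _)))
    exact le_antisymm (le_of_tendsto_of_tendsto' h1 h2 h3) (hF0 _)
  · -- `r = id` on `{F = 0}`: the iteration is stationary there
    intro z hz0
    have hfix : Φv z = z := by
      have := hΦ z
      rw [hz0, mul_zero] at this
      exact sub_eq_zero.1 (norm_le_zero_iff.1 this)
    have hconst : (fun k => Φv^[k] z) = fun _ => z := by
      funext k
      exact Function.iterate_fixed hfix k
    have hzV : z ∈ V := by
      change F z * (1 + ‖z‖) ^ d < ε
      rw [hz0, zero_mul]; exact hεpos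
    have := hconv z hzV
    rw [hconst] at this
    exact (tendsto_nhds_unique this tendsto_const_nhds).symm ▸ rfl


/-! ### The polyhedron and the retraction -/

/-- Polynomial functions are complex-differentiable on `ℂ^ι`. [folklore] -/
private theorem differentiable_eval (p : MvPolynomial ι ℂ) : Differentiable ℂ fun z : ι → ℂ => eval z p := by
  induction p using MvPolynomial.induction_on with
  | C a => simp
  | add p q hp hq => simp only [map_add]; exact hp.add hq
  | mul_X p i hp => simp only [map_mul, eval_X]; exact hp.mul (differentiable_apply i)

/-- `(max 1 x)^d ≤ 1 + x^d`-type bound: `(1 + x)^d ≤ 2^d (1 + x^d)` for `x ≥ 0`. [folklore] -/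
private theorem one_add_pow_le_two_pow_mul {x : ℝ} (hx : 0 ≤ x) (d : ℕ) :
    (1 + x) ^ d ≤ 2 ^ d * (1 + x ^ d) := by
  rcases le_total x 1 with h | h
  · calc (1 + x) ^ d ≤ (2 : ℝ) ^ d := pow_le_pow_left₀ (by positivity) (by linarith) _
      _ ≤ 2 ^ d * (1 + x ^ d) := le_mul_of_one_le_right (by positivity) (by
          have := pow_nonneg hx d; linarith)
  · calc (1 + x) ^ d ≤ (2 * x) ^ d := pow_le_pow_left₀ (by positivity) (by linarith) _
      _ = 2 ^ d * x ^ d := mul_pow _ _ _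
      _ ≤ 2 ^ d * (1 + x ^ d) := by gcongr; linarith

/-- For the sup norm on `ℂ^ι` and `d ≥ 1`: `|a| · ‖z‖^d ≤ η` as soon as `|a| · |z_i|^d ≤ η` for every
`i` (the sup is attained, or `ι` is empty and `‖z‖ = 0`). [folklore] -/
private theorem mul_norm_pow_le_of_forall {a η : ℝ} (ha : 0 ≤ a) (hη : 0 ≤ η) {d : ℕ} (hd : 1 ≤ d)
    (z : ι → ℂ) (h : ∀ i, a * ‖z i‖ ^ d ≤ η) : a * ‖z‖ ^ d ≤ η := by
  rcases isEmpty_or_nonempty ι with hι | hι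
  · have : z = 0 := Subsingleton.elim _ _
    rw [this, norm_zero, zero_pow (by omega), mul_zero]; exact hη
  · obtain ⟨i₀, -, hi₀⟩ := Finset.exists_max_image Finset.univ (fun i => ‖z i‖) Finset.univ_nonempty
    have hz : ‖z‖ ≤ ‖z i₀‖ := (pi_norm_le_iff_of_nonneg (norm_nonneg _)).2 fun i => hi₀ i (by simp)
    calc a * ‖z‖ ^ d ≤ a * ‖z i₀‖ ^ d := by gcongr
      _ ≤ η := h i₀

/-- **The zero set of an ideal with a first-order retraction is a holomorphic retract of an open
polynomial polyhedron.** For `f₁,…,f_m` and `Φ` with `Φ_i - X_i ∈ J = (f_j)` and `f_j(Φ) ∈ J²` there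
are finitely many polynomials `P_k` (namely `η⁻¹ f_j` and `η⁻¹ f_j X_i^d`) and a map `r`, holomorphic
on the open polyhedron `W = {z : |P_k(z)| < 1 ∀ k}`, with `Z = {f_j = 0 ∀ j} ⊆ W`, `r(W) ⊆ Z` and
`r = id` on `Z`. (In print the existence of holomorphic neighbourhood retractions onto closed Stein
submanifolds is Docquier–Grauert's theorem, Math. Ann. 140 (1960); the first-order retraction is the
splitting of Stacks 031I.) [cite: StacksProject, Tag 031I] [cite: HormanderSCV1973, Thm. 2.7.8] -/
theorem exists_polyhedron_retract (Φ : ι → MvPolynomial ι ℂ)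
    (hΦ₁ : ∀ i, Φ i - X i ∈ Ideal.span (Set.range f))
    (hΦ₂ : ∀ j, bind₁ Φ (f j) ∈ Ideal.span (Set.range f) ^ 2) :
    ∃ (P : Fin m ⊕ Fin m × ι → MvPolynomial ι ℂ) (r : (ι → ℂ) → (ι → ℂ)),
      {z | ∀ j, eval z (f j) = 0} ⊆ {z | ∀ k, ‖eval z (P k)‖ < 1} ∧
      DifferentiableOn ℂ r {z | ∀ k, ‖eval z (P k)‖ < 1} ∧
      MapsTo r {z | ∀ k, ‖eval z (P k)‖ < 1} {z | ∀ j, eval z (f j) = 0} ∧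
      ∀ z, (∀ j, eval z (f j) = 0) → r z = z := by
  classical
  obtain ⟨C, d, hC, hd, hest⟩ := exists_newton_estimates f Φ hΦ₁ hΦ₂
  -- the data of `exists_newton_limit`
  set F : (ι → ℂ) → ℝ := fun z => ∑ j, ‖eval z (f j)‖ with hF
  set Φv : (ι → ℂ) → (ι → ℂ) := fun z i => eval z (Φ i) with hΦv
  have hF0 : ∀ z, 0 ≤ F z := fun z => Finset.sum_nonneg fun _ _ => norm_nonneg _
  have hFc : Continuous F :=
    continuous_finsetSum _ fun j _ => (differentiable_eval (f j)).continuous.norm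
  have hΦd : Differentiable ℂ Φv := differentiable_pi.2 fun i => differentiable_eval (Φ i)
  obtain ⟨r, -, hrd, hrF, hrid⟩ :=
    exists_newton_limit hC hF0 hFc hΦd (fun z => (hest z).1) (fun z => (hest z).2)
  have hCpos : 0 < C := lt_of_lt_of_le one_pos hC
  set ε : ℝ := 1 / (2 ^ (d + 1) * C) with hε
  have hεpos : 0 < ε := by rw [hε]; positivity
  -- the polyhedron
  set η : ℝ := ε / (2 ^ (d + 1) * (m + 1)) with hη
  have hηpos : 0 < η := by rw [hη]; positivity
  set P : Fin m ⊕ Fin m × ι → MvPolynomial ι ℂ :=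
    Sum.elim (fun j => MvPolynomial.C ((η : ℂ)⁻¹) * f j)
      (fun ji => MvPolynomial.C ((η : ℂ)⁻¹) * (f ji.1 * X ji.2 ^ d)) with hP
  have hnormη : ‖((η : ℂ)⁻¹)‖ = η⁻¹ := by
    rw [norm_inv, Complex.norm_real, Real.norm_of_nonneg hηpos.le]
  have hPl : ∀ z j, ‖eval z (P (Sum.inl j))‖ = η⁻¹ * ‖eval z (f j)‖ := fun z j => by
    simp only [hP, Sum.elim_inl, map_mul, eval_C, norm_mul, hnormη]
  have hPr : ∀ z j i, ‖eval z (P (Sum.inr (j, i)))‖ = η⁻¹ * (‖eval z (f j)‖ * ‖z i‖ ^ d) :=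
    fun z j i => by
    simp only [hP, Sum.elim_inr, map_mul, map_pow, eval_C, eval_X, norm_mul, norm_pow, hnormη]
  -- `Z ⊆ W`
  have hZW : {z : ι → ℂ | ∀ j, eval z (f j) = 0} ⊆ {z | ∀ k, ‖eval z (P k)‖ < 1} := by
    intro z hz k
    rcases k with j | ⟨j, i⟩
    · rw [hPl, hz j]; simp
    · rw [hPr, hz j]; simp
  -- `W ⊆ V = {F (1+‖z‖)^d < ε}`
  have hWV : {z : ι → ℂ | ∀ k, ‖eval z (P k)‖ < 1} ⊆ {z | F z * (1 + ‖z‖) ^ d < ε} := by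
    intro z hz
    have hfj : ∀ j, ‖eval z (f j)‖ ≤ η := fun j => by
      have := hz (Sum.inl j)
      rw [hPl, inv_mul_lt_iff₀ hηpos, mul_one] at this
      exact this.le
    have hfji : ∀ j i, ‖eval z (f j)‖ * ‖z i‖ ^ d ≤ η := fun j i => by
      have := hz (Sum.inr (j, i))
      rw [hPr, inv_mul_lt_iff₀ hηpos, mul_one] at this
      exact this.le
    have hterm : ∀ j, ‖eval z (f j)‖ * (1 + ‖z‖) ^ d ≤ 2 ^ (d + 1) * η := fun j => by
      have h1 := one_add_pow_le_two_pow_mul (norm_nonneg z) d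
      have h2 : ‖eval z (f j)‖ * ‖z‖ ^ d ≤ η :=
        mul_norm_pow_le_of_forall (norm_nonneg _) hηpos.le hd z (hfji j)
      calc ‖eval z (f j)‖ * (1 + ‖z‖) ^ d ≤ ‖eval z (f j)‖ * (2 ^ d * (1 + ‖z‖ ^ d)) :=
            mul_le_mul_of_nonneg_left h1 (norm_nonneg _)
        _ = 2 ^ d * (‖eval z (f j)‖ + ‖eval z (f j)‖ * ‖z‖ ^ d) := by ring
        _ ≤ 2 ^ d * (η + η) := by gcongr; exact hfj j
        _ = 2 ^ (d + 1) * η := by ring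
    change F z * (1 + ‖z‖) ^ d < ε
    calc F z * (1 + ‖z‖) ^ d = ∑ j, ‖eval z (f j)‖ * (1 + ‖z‖) ^ d := by rw [hF, Finset.sum_mul]
      _ ≤ ∑ _j : Fin m, 2 ^ (d + 1) * η := Finset.sum_le_sum fun j _ => hterm j
      _ = m * (2 ^ (d + 1) * η) := by simp
      _ < (m + 1) * (2 ^ (d + 1) * η) := by gcongr; linarith
      _ = ε := by rw [hη]; field_simp
  refine ⟨P, r, hZW, hrd.mono hWV, fun z hz => ?_, fun z hz => hrid z ?_⟩
  · -- `r(W) ⊆ Z`: `F (r z) = 0`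
    have h0 : F (r z) = 0 := hrF z (hWV hz)
    have := (Finset.sum_eq_zero_iff_of_nonneg fun j _ => norm_nonneg (eval (r z) (f j))).1 h0
    intro j
    exact norm_eq_zero.1 (this j (Finset.mem_univ j))
  · change ∑ j, ‖eval z (f j)‖ = 0
    exact Finset.sum_eq_zero fun j _ => by rw [hz j, norm_zero]

/-! ### The form consumed downstream: a holomorphic retract of a `∂̄`-acyclic open set -/

/-- **Zero sets with a first-order retraction are holomorphic retracts of `∂̄`-acyclic open subsets of
`ℂ^ι`** (generators form): there are an open `U ⊆ ℂ^ι` with `H^{p,q+1}_{∂̄}(U) = 0` for all `p, q`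
(an open polynomial polyhedron, Hörmander Thm. 2.7.8) and `r : ℂ^ι → ℂ^ι` holomorphic on `U` with
`Z ⊆ U`, `r(U) ⊆ Z`, `r|_Z = id`. [cite: HormanderSCV1973, Thm. 2.7.8] -/
theorem exists_acyclic_retract (Φ : ι → MvPolynomial ι ℂ)
    (hΦ₁ : ∀ i, Φ i - X i ∈ Ideal.span (Set.range f))
    (hΦ₂ : ∀ j, bind₁ Φ (f j) ∈ Ideal.span (Set.range f) ^ 2) :
    ∃ (U : TopologicalSpace.Opens (ι → ℂ)) (r : (ι → ℂ) → (ι → ℂ)),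
      {z | ∀ j, eval z (f j) = 0} ⊆ U ∧
      (∀ p q : ℕ, Subsingleton (dolbeaultCohomology (ι → ℂ) U p (q + 1))) ∧
      DifferentiableOn ℂ r U ∧ MapsTo r U {z | ∀ j, eval z (f j) = 0} ∧
      ∀ z, (∀ j, eval z (f j) = 0) → r z = z := by
  classical
  obtain ⟨P, r, hZW, hrd, hrZ, hrid⟩ := exists_polyhedron_retract f Φ hΦ₁ hΦ₂
  have hPd : ∀ k, Differentiable ℂ fun z : ι → ℂ => eval z (P k) := fun k => differentiable_eval (P k)
  let U : TopologicalSpace.Opens (ι → ℂ) :=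
    ⟨{z | ∀ k, ‖eval z (P k)‖ < 1}, by
      rw [show {z : ι → ℂ | ∀ k, ‖eval z (P k)‖ < 1} = ⋂ k, {z | ‖eval z (P k)‖ < 1} by ext; simp]
      exact isOpen_iInter_of_finite fun k => isOpen_lt (hPd k).continuous.norm continuous_const⟩
  exact ⟨U, r, hZW, fun p q =>
    subsingleton_dolbeaultCohomology_of_forall_norm_lt (fun k z => eval z (P k)) hPd U rfl p q,
    hrd, hrZ, hrid⟩

/-- **Ideal form.** For a finitely generated ideal `J ≤ ℂ[X_i : i ∈ ι]` admitting a first-order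
retraction `Φ` (`Φ_i - X_i ∈ J`, `p(Φ) ∈ J²` for all `p ∈ J` — Stacks 031I: the surjection
`ℂ[X]/J² → ℂ[X]/J` has an algebra section, which holds when `ℂ[X]/J` is formally smooth over `ℂ`), the
zero set `V(J) ⊆ ℂ^ι` is a holomorphic retract of a `∂̄`-acyclic open subset of `ℂ^ι`.
[cite: StacksProject, Tag 031I] [cite: HormanderSCV1973, Thm. 2.7.8] -/
theorem exists_acyclic_retract_of_ideal (J : Ideal (MvPolynomial ι ℂ)) (hJ : J.FG)
    (Φ : ι → MvPolynomial ι ℂ) (hΦ₁ : ∀ i, Φ i - X i ∈ J) (hΦ₂ : ∀ p ∈ J, bind₁ Φ p ∈ J ^ 2) :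
    ∃ (U : TopologicalSpace.Opens (ι → ℂ)) (r : (ι → ℂ) → (ι → ℂ)),
      {z | ∀ p ∈ J, eval z p = 0} ⊆ U ∧
      (∀ p q : ℕ, Subsingleton (dolbeaultCohomology (ι → ℂ) U p (q + 1))) ∧
      DifferentiableOn ℂ r U ∧ MapsTo r U {z | ∀ p ∈ J, eval z p = 0} ∧
      ∀ z, (∀ p ∈ J, eval z p = 0) → r z = z := by
  obtain ⟨m, f, hf⟩ := Submodule.fg_iff_exists_fin_generating_family.1 hJ
  have hJf : Ideal.span (Set.range f) = J := hf
  -- the zero set of `J` is the common zero set of the generators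
  have hZ : ∀ z : ι → ℂ, (∀ p ∈ J, eval z p = 0) ↔ ∀ j, eval z (f j) = 0 := by
    intro z
    constructor
    · exact fun h j => h (f j) (hJf ▸ Ideal.subset_span (Set.mem_range_self j))
    · intro h p hp
      rw [← hJf] at hp
      have : Ideal.span (Set.range f) ≤ RingHom.ker (eval z) :=
        Ideal.span_le.2 (Set.range_subset_iff.2 fun j => (RingHom.mem_ker).2 (h j))
      exact (RingHom.mem_ker).1 (this hp)
  obtain ⟨U, r, h1, h2, h3, h4, h5⟩ := exists_acyclic_retract f Φ (fun i => hJf ▸ hΦ₁ i)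
    fun j => hJf ▸ hΦ₂ _ (hJf ▸ Ideal.subset_span (Set.mem_range_self j))
  exact ⟨U, r, fun z hz => h1 ((hZ z).1 hz), h2, h3, fun z hz => (hZ _).2 (h4 hz),
    fun z hz => h5 z ((hZ z).1 hz)⟩

end NewtonRetract

end Literature.Analysis.Complex
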